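import Literature.Barriers.CriticalPhenomena.PositionSpaceRGNonGibbsianPeierlsCondition
import Literature.Barriers.CriticalPhenomena.PositionSpaceRGNonGibbsianChessboard
import Literature.Probability.LatticeModels.InfraredBoundProofs
import Mathlib.Algebra.QuadraticDiscriminant
import HarnessLib

/-!
# The internal-spin system with alternating frozen image spins on a torus: reflection positivity,
# and the chessboard estimate for bad cells

Support file for the Theorem 4.3 line of the barrier
`Literature/Barriers/CriticalPhenomena/PositionSpaceRGNonGibbsian.lean` (van Enter–Fernández–Sokal,
J. Stat. Phys. **72** (1993), Theorem 4.3; §4.3.2 and App. B.5.3 obtain the `+` phase of the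
internal-spin system with fully alternating image spins for spacings `b ≥ 3` from Pirogov–Sinai
theory; this line of files replaces that input by reflection positivity and a chessboard–Peierls
argument on a torus — Fröhlich–Lieb, Comm. Math. Phys. **60** (1978); Fröhlich–Israel–Lieb–Simon,
Comm. Math. Phys. **62** (1978); Friedli–Velenik 2017, Ch. 10; Biskup, LNM 1970 (2009), §5).

## Contents (namespace `Literature.Barriers.CriticalPhenomena.NonGibbs`), all proved

* **The model on the torus** `𝕋 = (ℤ/Lℤ)^d`, `L = N·b`: the image sites `TImg` (projections of
  `bℤ^d`), the frozen pattern `torusPin N b p` (`= p·ω'_alt(y)` at the projection of `b·y`, well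
  defined for even `N`, `torusPin_proj`), the free (internal) sites `tFree`, and the finite-volume
  Gibbs measure of the tree `isingMeasure (torusGraph d L) tFree β 0 (.fixed (torusPin N b p))`
  with its expectation `tExpect` written as a finite Boltzmann sum over the configurations that
  agree with the pins (`tExpect_eq_tsum_div`).
* **Reflection positivity through image hyperplanes** (`tsum_mul_comp_reflect_sq_le`,
  `tExpect_mul_comp_reflect_sq_le`): for the reflection `θ` through the sites `xᵢ = kb`,
  `xᵢ = kb + L/2` and observables `f, g` depending only on the spins in the half-torus
  `𝕋₊ = {(xᵢ - kb).val ≤ L/2}`, `⟨f · (g ∘ θ)⟩² ≤ ⟨f · (f ∘ θ)⟩ ⟨g · (g ∘ θ)⟩`. Proof: the pins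
  are `θ`-invariant (`torusPin_reflect`), the Boltzmann sum over pinned configurations is the sum
  over ALL configurations of `u(σ) v(σ ∘ θ)` with `u = e^{a} f · 𝟙[σ = pins on the images of 𝕋₊]`
  (`-βH = a + a∘θ*`, Friedli–Velenik Example 10.9, tree lemma
  `exists_neg_mul_isingHamiltonian_eq_add_comp`), this bilinear form is positive semidefinite on
  `𝕋₊`-local observables (Friedli–Velenik Lemma 10.7, tree lemma `sum_conj_reflect_mul_re_nonneg`)
  and symmetric, whence Cauchy–Schwarz.
* **Cells and bad cells.** The closed cells `cellZ c = [cb, cb + b]^d ⊂ ℤ^d` (`c ∈ ℤ^d`), their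
  internal sites `freeCellZ`, projected to the torus; a cell is BAD for `σ` if `σ` is not constant on
  its internal sites (`BadCell`, indicator `badInd`). Badness only depends on the spins of the cell
  (`badCell_congr`), is `N`-periodic in `c` (`badCell_iff_of_dvd`), and transforms under the
  reflection `θ` through image hyperplanes as the block reflection `c ↦ c[i ↦ 2k-1-cᵢ]`
  (`badCell_comp_tRefl`).
* **The chessboard estimate for bad cells.** With cell indices `c̄ ∈ (ℤ/Nℤ)^d` lifted to lower
  corners `liftIdx c̄ ∈ ℤ^d` (`badIdx`, `prodBad S = ∏_{c̄ ∈ S} badIdx c̄`): `badIdx_comp_tRefl`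
  (`badIdx c̄ (σ ∘ θ) = badIdx (cellReflect i k c̄) σ`), `badIdx_local` (cells of the positive half
  of the block torus are `𝕋₊`-local), hence `tExpect_prodBad_sq_le`: `ψ(S)² ≤ ψ(symP S) ψ(symM S)`
  for `ψ(S) = ⟨prodBad S⟩` by the reflection positivity above; an all-bad pinned configuration
  exists (`exists_forall_badCell`), so `ψ(univ) > 0`; and the abstract `chessboard_le_pow_of_le`
  of `…Chessboard.lean` gives **`tExpect_prodBad_le_pow`**: for `N = 2^(n+1)`, `d ≥ 2`, `b ≥ 2`, if
  the probability that ALL cells are bad is at most `ε^(N^d)` then `⟨prodBad S⟩ ≤ ε^#S` for every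
  set `S` of cells (`tExpect_prod_badInd_le_pow`: the same for cells indexed by corners in `ℤ^d`
  pairwise incongruent mod `N`). The dissemination bound `ε = 2^{b^d} e^{-β/2^d}` is NOT here
  (sibling file `…TorusPeierls.lean`).

No named facts are introduced (D-0014, D-0026).

## References

* A. C. D. van Enter, R. Fernández, A. D. Sokal, J. Stat. Phys. 72 (1993) 879–1167, Theorem 4.3,
  §4.3.2, App. B.5.3 [VanenterFernandezSokal1993].
* S. Friedli, Y. Velenik, *Statistical Mechanics of Lattice Systems*, CUP 2017, Lemma 10.7,
  Lemma 10.8, Example 10.9, Theorem 10.11 [FriedliVelenik2017].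
* J. Fröhlich, R. Israel, E. H. Lieb, B. Simon, Comm. Math. Phys. 62 (1978) 1–34
  [FrohlichIsraelLiebSimon1978].
* M. Biskup, LNM 1970 (2009), §5 [Biskup2009].
-/

noncomputable section

open scoped ComplexConjugate

namespace Literature.Barriers.CriticalPhenomena.NonGibbs

open Finset MeasureTheory Literature.Probability.LatticeModels

variable {d : ℕ}

/-! ### Parity of the alternating configuration -/

/-- `ω'_alt` only depends on the parity of the coordinate sum. [cite: VanenterFernandezSokal1993, eq. (4.2)] -/
theorem altConfig_eq_of_even_sub {y y' : Site d} (h : Even (∑ i, y i - ∑ i, y' i)) :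
    altConfig d y = altConfig d y' := by
  rw [altConfig_apply, altConfig_apply]
  have : ∑ i, y i = (∑ i, y i - ∑ i, y' i) + ∑ i, y' i := by ring
  obtain ⟨m, hm⟩ := h
  rw [this, uzpow_add, hm, uzpow_add, Int.units_mul_self, one_mul]

/-- `ω'_alt` is `N`-periodic in every coordinate direction for even `N`.
[cite: VanenterFernandezSokal1993, eq. (4.2)] -/
theorem altConfig_eq_of_dvd_sub {N : ℕ} (hN : Even N) {y y' : Site d} (h : ∀ i, (N : ℤ) ∣ y i - y' i) :
    altConfig d y = altConfig d y' := by
  refine altConfig_eq_of_even_sub ?_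
  rw [← Finset.sum_sub_distrib]
  refine Finset.even_sum _ fun i _ => ?_
  obtain ⟨m, hm⟩ := hN
  obtain ⟨c, hc⟩ := h i
  exact ⟨m * c, by rw [hc, hm]; push_cast; ring⟩

/-- `ω'_alt` is invariant under the reflection `yᵢ ↦ 2k - yᵢ` of one coordinate.
[cite: VanenterFernandezSokal1993, eq. (4.2)] -/
theorem altConfig_update_reflect (y : Site d) (i : Fin d) (k : ℤ) :
    altConfig d (Function.update y i (2 * k - y i)) = altConfig d y := by
  refine altConfig_eq_of_even_sub ?_
  rw [← Finset.sum_sub_distrib, Finset.sum_eq_single i]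
  · rw [Function.update_self]; exact ⟨k - y i, by ring⟩
  · intro j _ hj; rw [Function.update_of_ne hj, sub_self]
  · intro h; exact absurd (mem_univ i) h

/-! ### The torus `(ℤ/Nbℤ)^d`: projection, image sites and the frozen pattern -/

section Torus

variable {N b : ℕ}

variable (N b) in
/-- The projection of `b·y`, `y ∈ ℤ^d`: the image sites of the torus of side `N·b`.
[cite: VanenterFernandezSokal1993, §3.1.2 eq. (3.7)] -/
def tImg (y : Site d) : TorusSite d (N * b) := Torus.proj (N * b) fun i => (b : ℤ) * y i

variable (N b) in
/-- A torus site is an **image site** if it is the projection of a point of `bℤ^d`.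
[cite: VanenterFernandezSokal1993, §3.1.2 eq. (3.7)] -/
def TImg (x : TorusSite d (N * b)) : Prop := ∃ y : Site d, x = tImg N b y

/-- Two points of `bℤ^d` have the same projection iff they differ by an element of `Nbℤ^d`.
[folklore] -/
theorem tImg_eq_tImg_iff (hb : 0 < b) {y y' : Site d} :
    tImg N b y = tImg N b y' ↔ ∀ i, (N : ℤ) ∣ y' i - y i := by
  simp only [tImg, Torus.proj, funext_iff]
  refine forall_congr' fun i => ?_
  rw [ZMod.intCast_eq_intCast_iff_dvd_sub]
  push_cast
  rw [← mul_sub]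
  constructor
  · rintro ⟨c, hc⟩
    refine ⟨c, ?_⟩
    have hb' : (b : ℤ) ≠ 0 := by exact_mod_cast hb.ne'
    have : (b : ℤ) * (y' i - y i) = (b : ℤ) * (N * c) := by rw [hc]; ring
    exact mul_left_cancel₀ hb' this
  · rintro ⟨c, hc⟩
    exact ⟨c, by rw [hc]; ring⟩

/-- The projection of a point of `ℤ^d` is an image site iff the point lies in `bℤ^d`.
[cite: VanenterFernandezSokal1993, §3.1.2 eq. (3.7)] -/
theorem tImg_proj_iff {y : Site d} :
    TImg N b (Torus.proj (N * b) y) ↔ IsSpImageSite d b y := by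
  constructor
  · rintro ⟨y', hy'⟩
    intro i
    have h := congrFun hy' i
    simp only [Torus.proj, tImg] at h
    rw [ZMod.intCast_eq_intCast_iff_dvd_sub] at h
    push_cast at h
    obtain ⟨c, hc⟩ := h
    exact ⟨y' i - N * c, by linear_combination -hc⟩
  · intro hy
    choose w hw using hy
    refine ⟨w, funext fun i => ?_⟩
    simp only [Torus.proj, tImg, hw i]

/-- Image points project to image sites. [cite: VanenterFernandezSokal1993, §3.1.2 eq. (3.7)] -/
theorem tImg_tImg (y : Site d) : TImg N b (tImg N b y) := ⟨y, rfl⟩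

/-- A unit step of the torus from the projection of `y` is the projection of the unit step of
`ℤ^d`. [folklore] -/
theorem proj_add_single (L : ℕ) (y : Site d) (i : Fin d) :
    Torus.proj L y + Pi.single i 1 = Torus.proj L (y + Pi.single i 1) := by
  funext j
  by_cases hj : j = i
  · subst hj; simp [Torus.proj]
  · simp [Torus.proj, hj]

/-- For `b ≥ 2` no two image sites of the torus are adjacent.
[cite: VanenterFernandezSokal1993, §4.1.2 Step 1] -/
theorem not_adj_of_tImg (hb : 2 ≤ b) {x x' : TorusSite d (N * b)} (hx : TImg N b x) (hx' : TImg N b x')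
    : ¬ (torusGraph d (N * b)).Adj x x' := by
  intro hadj
  -- a unit step between two projections of `bℤ^d` forces `b ∣ 1`
  have key : ∀ (y y' : Site d) (i : Fin d), tImg N b y' = tImg N b y + Pi.single i 1 → False := by
    intro y y' i h
    have h1 := congrFun h i
    simp only [tImg, Torus.proj, Pi.add_apply, Pi.single_eq_same] at h1
    have h2 : (((b : ℤ) * y' i : ℤ) : ZMod (N * b)) = (((b : ℤ) * y i + 1 : ℤ) : ZMod (N * b)) := by
      push_cast at h1 ⊢; exact h1
    rw [ZMod.intCast_eq_intCast_iff_dvd_sub] at h2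
    obtain ⟨c, hc⟩ := h2
    have : (b : ℤ) ∣ 1 := ⟨y' i - y i + N * c, by push_cast at hc; linear_combination hc⟩
    have hb1 : (b : ℤ) ≤ 1 := Int.le_of_dvd one_pos this
    omega
  obtain ⟨y, rfl⟩ := hx
  obtain ⟨y', rfl⟩ := hx'
  rw [torusGraph_adj_iff] at hadj
  rcases hadj.2 with ⟨i, h⟩ | ⟨i, h⟩
  · exact key y y' i h
  · exact key y' y i h

variable (N b) in
/-- **The frozen image spins of the torus**: `p · ω'_alt(y)` at the projection of `b·y` (well defined
for even `N`, `torusPin_proj`), and the junk value `1` at internal sites (never read).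
[cite: VanenterFernandezSokal1993, §4.3.2 (the fully alternating block-spin configuration)] -/
def torusPin (p : ℤˣ) (x : TorusSite d (N * b)) : ℤˣ :=
  open Classical in if h : TImg N b x then p * altConfig d (Classical.choose h) else 1

/-- **The frozen pattern at an image site**: `torusPin N b p (tImg y) = p · ω'_alt(y)` for even `N`.
[cite: VanenterFernandezSokal1993, §4.3.2] -/
theorem torusPin_proj (hN : Even N) (hb : 0 < b) (p : ℤˣ) (y : Site d) :
    torusPin N b p (tImg N b y) = p * altConfig d y := by
  classical
  have h : TImg N b (tImg N b y) := tImg_tImg y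
  rw [torusPin, dif_pos h]
  congr 1
  have hspec := Classical.choose_spec h
  exact altConfig_eq_of_dvd_sub hN ((tImg_eq_tImg_iff hb).1 hspec)

/-- **The frozen pattern is invariant under reflections through image hyperplanes**
`xᵢ ↦ 2kb - xᵢ` (at image sites). [cite: VanenterFernandezSokal1993, §4.3.2] -/
theorem torusPin_reflect (hN : Even N) (hb : 0 < b) (p : ℤˣ) (i : Fin d) (k : ℤ) (y : Site d) :
    torusPin N b p (Torus.reflectThroughSites i (((b : ℤ) * k : ℤ) : ZMod (N * b)) (tImg N b y)) =
      torusPin N b p (tImg N b y) := by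
  have h : Torus.reflectThroughSites i (((b : ℤ) * k : ℤ) : ZMod (N * b)) (tImg N b y) =
      tImg N b (Function.update y i (2 * k - y i)) := by
    funext j
    by_cases hj : j = i
    · subst hj
      simp only [Torus.reflectThroughSites_apply, Function.update_self, tImg, Torus.proj]
      push_cast; ring
    · simp [Torus.reflectThroughSites_apply, hj, tImg, Torus.proj]
  rw [h, torusPin_proj hN hb, torusPin_proj hN hb, altConfig_update_reflect]

/-- Reflections through image hyperplanes map image points to image points. [folklore] -/
theorem reflect_tImg (i : Fin d) (k : ℤ) (y : Site d) :
    Torus.reflectThroughSites i (((b : ℤ) * k : ℤ) : ZMod (N * b)) (tImg N b y) =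
      tImg N b (Function.update y i (2 * k - y i)) := by
  funext j
  by_cases hj : j = i
  · subst hj
    simp only [Torus.reflectThroughSites_apply, Function.update_self, tImg, Torus.proj]
    push_cast; ring
  · simp [Torus.reflectThroughSites_apply, hj, tImg, Torus.proj]

/-- Reflections through image hyperplanes preserve the set of image sites. [folklore] -/
theorem tImg_reflect_iff (i : Fin d) (k : ℤ) (x : TorusSite d (N * b)) :
    TImg N b (Torus.reflectThroughSites i (((b : ℤ) * k : ℤ) : ZMod (N * b)) x) ↔ TImg N b x := by
  constructor
  · rintro ⟨y, hy⟩
    have := congrArg (Torus.reflectThroughSites i (((b : ℤ) * k : ℤ) : ZMod (N * b))) hy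
    rw [show Torus.reflectThroughSites i (((b : ℤ) * k : ℤ) : ZMod (N * b))
        (Torus.reflectThroughSites i (((b : ℤ) * k : ℤ) : ZMod (N * b)) x) = x from
      Torus.reflectThroughSites_involutive i _ x, reflect_tImg] at this
    exact ⟨_, this⟩
  · rintro ⟨y, rfl⟩
    rw [reflect_tImg]
    exact tImg_tImg _

/-- **The frozen pattern alternates along the image lattice**: shifting an image point by `b eⱼ`
flips its frozen spin. In particular the lift of the frozen pattern to `ℤ^d` has isolated `-` spins.
[cite: VanenterFernandezSokal1993, §4.3.2 and App. B.5.3] -/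
theorem torusPin_tImg_add_single (hN : Even N) (hb : 0 < b) (p : ℤˣ) (y : Site d) (j : Fin d) :
    torusPin N b p (tImg N b (y + Pi.single j 1)) = -torusPin N b p (tImg N b y) := by
  rw [torusPin_proj hN hb, torusPin_proj hN hb, altConfig_add_single, mul_neg]

end Torus

/-- `N·b` is even for even `N`. [folklore] -/
theorem even_mul_side {N : ℕ} (hN : Even N) (b : ℕ) : Even (N * b) := hN.mul_right b

/-! ### The pinned Gibbs measure of the torus and its Boltzmann sums -/

section Model

variable {N b : ℕ} [NeZero (N * b)]

variable (N b) in
/-- **The internal (free) sites of the torus**: the complement of the image sites.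
[cite: VanenterFernandezSokal1993, §4.3.2 (the internal spins)] -/
def tFree : Finset (TorusSite d (N * b)) :=
  open Classical in univ.filter fun x => ¬ TImg N b x

/-- Membership in `tFree`. [cite: VanenterFernandezSokal1993, §4.3.2] -/
theorem mem_tFree {x : TorusSite d (N * b)} : x ∈ tFree N b ↔ ¬ TImg N b x := by
  classical
  simp [tFree]

variable (N b) in
/-- **Expectations of the internal-spin system on the torus with frozen alternating image spins**
(parity `p`), at inverse temperature `β` and zero field: the tree's finite-volume Gibbs expectation
of `torusGraph d (Nb)` in the volume `tFree` with boundary condition `torusPin N b p`.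
[cite: VanenterFernandezSokal1993, §4.3.2 and App. B.5.3] -/
def tExpect (p : ℤˣ) (β : ℝ) (f : SpinConfig (TorusSite d (N * b)) → ℝ) : ℝ :=
  isingExpect (torusGraph d (N * b)) (tFree N b) β 0 (.fixed (torusPin N b p)) f

variable (N b) in
/-- The configurations of the torus agreeing with the frozen image spins.
[cite: VanenterFernandezSokal1993, §4.3.2] -/
def tOmega (p : ℤˣ) : Finset (SpinConfig (TorusSite d (N * b))) :=
  univ.filter fun σ => ∀ x, x ∉ tFree N b → σ x = torusPin N b p x

/-- Membership in `tOmega`. [cite: VanenterFernandezSokal1993, §4.3.2] -/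
theorem mem_tOmega {p : ℤˣ} {σ : SpinConfig (TorusSite d (N * b))} :
    σ ∈ tOmega N b p ↔ ∀ x, x ∉ tFree N b → σ x = torusPin N b p x := by
  simp [tOmega]

variable (N b) in
/-- **The Boltzmann sum over pinned configurations** `∑_{σ = pins off tFree} e^{-βH(σ)} F(σ)`, with the
nearest-neighbour Hamiltonian of the whole torus. [cite: FriedliVelenik2017, §3.1 eq. (3.7)] -/
def tBsum (p : ℤˣ) (β : ℝ) (F : SpinConfig (TorusSite d (N * b)) → ℝ) : ℝ :=
  ∑ σ ∈ tOmega N b p, Real.exp (-β * isingHamiltonian (torusGraph d (N * b)) univ 0 .free σ) * F σ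

/-- For `b ≥ 2` every bond of the torus touches an internal site: the interaction edges of the
volume `tFree` are all the bonds. [cite: VanenterFernandezSokal1993, §4.1.2 Step 1] -/
theorem edgesTouching_tFree (hb : 2 ≤ b) :
    edgesTouching (torusGraph d (N * b)) (tFree N b) = edgesIn (torusGraph d (N * b)) univ := by
  rw [← edgesTouching_univ]
  refine Subset.antisymm (edgesTouching_mono _ (subset_univ _)) fun e he => ?_
  rw [mem_edgesTouching_iff] at he ⊢
  obtain ⟨he, -⟩ := he
  refine ⟨he, ?_⟩
  induction e using Sym2.ind with
  | _ x y =>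
    have hadj : (torusGraph d (N * b)).Adj x y := by simpa using he
    by_cases hx : TImg N b x
    · refine ⟨y, mem_tFree.2 fun hy => not_adj_of_tImg hb hx hy hadj, Sym2.mem_mk_right _ _⟩
    · exact ⟨x, mem_tFree.2 hx, Sym2.mem_mk_left _ _⟩

/-- The Hamiltonian of the volume `tFree` with frozen image spins is the nearest-neighbour
Hamiltonian of the whole torus (zero field, `b ≥ 2`). [cite: FriedliVelenik2017, §3.1 eqs. (3.2), (3.6)] -/
theorem isingHamiltonian_tFree_eq (hb : 2 ≤ b) (ζ : SpinConfig (TorusSite d (N * b)))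
    (σ : SpinConfig (TorusSite d (N * b))) :
    isingHamiltonian (torusGraph d (N * b)) (tFree N b) 0 (.fixed ζ) σ =
      isingHamiltonian (torusGraph d (N * b)) univ 0 .free σ := by
  simp only [isingHamiltonian, interactionEdges_fixed, interactionEdges_free, edgesTouching_tFree hb,
    zero_mul, sub_zero]

/-- The pinned configurations are exactly the glued ones. [cite: FriedliVelenik2017, §3.1 (Ω_Λ^η)] -/
theorem tOmega_eq_image (p : ℤˣ) :
    tOmega (d := d) N b p = univ.image fun τ : ↥(tFree N b) → ℤˣ => glue (tFree N b) τ (.fixed (torusPin N b p)) := by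
  ext σ
  rw [mem_tOmega, mem_image]
  constructor
  · intro h
    refine ⟨fun x => σ x, mem_univ _, funext fun x => ?_⟩
    by_cases hx : x ∈ tFree N b
    · rw [glue_apply_of_mem _ _ _ hx]
    · rw [glue_apply_of_notMem _ _ _ hx, BoundaryCondition.outside_fixed, h x hx]
  · rintro ⟨τ, -, rfl⟩ x hx
    rw [glue_apply_of_notMem _ _ _ hx, BoundaryCondition.outside_fixed]

/-- **Sums over glued configurations are sums over pinned configurations.**
[cite: FriedliVelenik2017, §3.1 (Ω_Λ^η)] -/
theorem sum_glue_tFree (p : ℤˣ) (F : SpinConfig (TorusSite d (N * b)) → ℝ) :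
    ∑ τ : ↥(tFree N b) → ℤˣ, F (glue (tFree N b) τ (.fixed (torusPin N b p))) = ∑ σ ∈ tOmega N b p, F σ := by
  rw [tOmega_eq_image, sum_image fun τ _ τ' _ h => glue_injective _ _ h]

/-- **The Gibbs expectation as a ratio of Boltzmann sums**: `⟨f⟩ = tBsum f / tBsum 1` (`b ≥ 2`).
[cite: FriedliVelenik2017, §3.1 eq. (3.8)] -/
theorem tExpect_eq_tBsum_div (hb : 2 ≤ b) (p : ℤˣ) (β : ℝ) (f : SpinConfig (TorusSite d (N * b)) → ℝ) :
    tExpect N b p β f = tBsum N b p β f / tBsum N b p β (fun _ : SpinConfig (TorusSite d (N * b)) => 1) := by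
  rw [tExpect, isingExpect, integral_isingMeasure _ _ _ _ _ (measurable_of_finite f), isingPartitionFunction]
  simp only [isingWeight, isingHamiltonian_tFree_eq hb]
  rw [sum_glue_tFree p (fun σ => Real.exp (-β * isingHamiltonian (torusGraph d (N * b)) univ 0 .free σ) * f σ),
    sum_glue_tFree p (fun σ => Real.exp (-β * isingHamiltonian (torusGraph d (N * b)) univ 0 .free σ))]
  simp only [tBsum, mul_one]

/-- The normalising Boltzmann sum is positive. [cite: FriedliVelenik2017, §3.1] -/
theorem tBsum_one_pos (p : ℤˣ) (β : ℝ) :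
    0 < tBsum N b p β (fun _ : SpinConfig (TorusSite d (N * b)) => (1 : ℝ)) := by
  rw [tBsum]
  refine sum_pos (fun σ _ => by rw [mul_one]; exact Real.exp_pos _) ?_
  rw [tOmega_eq_image]
  exact (univ_nonempty.image _)

/-- Boltzmann sums of nonnegative observables are nonnegative. [cite: FriedliVelenik2017, §3.1] -/
theorem tBsum_nonneg (p : ℤˣ) (β : ℝ) {F : SpinConfig (TorusSite d (N * b)) → ℝ} (hF : ∀ σ, 0 ≤ F σ) :
    0 ≤ tBsum N b p β F :=
  sum_nonneg fun σ _ => mul_nonneg (Real.exp_pos _).le (hF σ)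

/-- Boltzmann sums are monotone in the observable. [cite: FriedliVelenik2017, §3.1] -/
theorem tBsum_mono (p : ℤˣ) (β : ℝ) {F G : SpinConfig (TorusSite d (N * b)) → ℝ} (hFG : ∀ σ, F σ ≤ G σ) :
    tBsum N b p β F ≤ tBsum N b p β G :=
  sum_le_sum fun σ _ => mul_le_mul_of_nonneg_left (hFG σ) (Real.exp_pos _).le

/-- Boltzmann sums restricted to pinned configurations satisfying a predicate.
[cite: FriedliVelenik2017, §3.1] -/
theorem tBsum_mono_of_forall_mem (p : ℤˣ) (β : ℝ) {F G : SpinConfig (TorusSite d (N * b)) → ℝ}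
    (hFG : ∀ σ ∈ tOmega N b p, F σ ≤ G σ) : tBsum N b p β F ≤ tBsum N b p β G :=
  sum_le_sum fun σ hσ => mul_le_mul_of_nonneg_left (hFG σ hσ) (Real.exp_pos _).le

/-- Expectations of nonnegative observables are nonnegative. [cite: FriedliVelenik2017, §3.1] -/
theorem tExpect_nonneg (hb : 2 ≤ b) (p : ℤˣ) (β : ℝ) {f : SpinConfig (TorusSite d (N * b)) → ℝ}
    (hf : ∀ σ, 0 ≤ f σ) : 0 ≤ tExpect N b p β f := by
  rw [tExpect_eq_tBsum_div hb]
  exact div_nonneg (tBsum_nonneg p β hf) (tBsum_one_pos p β).le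

/-- The expectation of `1` is `1`. [cite: FriedliVelenik2017, §3.1] -/
theorem tExpect_one (hb : 2 ≤ b) (p : ℤˣ) (β : ℝ) :
    tExpect N b p β (fun _ : SpinConfig (TorusSite d (N * b)) => 1) = 1 := by
  rw [tExpect_eq_tBsum_div hb, div_self (tBsum_one_pos p β).ne']

/-- Expectations are monotone. [cite: FriedliVelenik2017, §3.1] -/
theorem tExpect_mono (hb : 2 ≤ b) (p : ℤˣ) (β : ℝ) {f g : SpinConfig (TorusSite d (N * b)) → ℝ}
    (hfg : ∀ σ, f σ ≤ g σ) : tExpect N b p β f ≤ tExpect N b p β g := by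
  rw [tExpect_eq_tBsum_div hb, tExpect_eq_tBsum_div hb]
  exact div_le_div_of_nonneg_right (tBsum_mono p β hfg) (tBsum_one_pos p β).le

/-- Linearity of expectations: sums. [cite: FriedliVelenik2017, §3.1] -/
theorem tExpect_add (hb : 2 ≤ b) (p : ℤˣ) (β : ℝ) (f g : SpinConfig (TorusSite d (N * b)) → ℝ) :
    tExpect N b p β (fun σ => f σ + g σ) = tExpect N b p β f + tExpect N b p β g := by
  simp only [tExpect_eq_tBsum_div hb, tBsum, mul_add, sum_add_distrib, add_div]

/-- Linearity of expectations: scalars. [cite: FriedliVelenik2017, §3.1] -/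
theorem tExpect_const_mul (hb : 2 ≤ b) (p : ℤˣ) (β : ℝ) (c : ℝ) (f : SpinConfig (TorusSite d (N * b)) → ℝ) :
    tExpect N b p β (fun σ => c * f σ) = c * tExpect N b p β f := by
  simp only [tExpect_eq_tBsum_div hb, tBsum]
  rw [mul_div_assoc', mul_sum]
  congr 1
  exact sum_congr rfl fun σ _ => by ring

/-- Finite sums of expectations. [cite: FriedliVelenik2017, §3.1] -/
theorem tExpect_finset_sum (hb : 2 ≤ b) (p : ℤˣ) (β : ℝ) {ι : Type*} (s : Finset ι)
    (f : ι → SpinConfig (TorusSite d (N * b)) → ℝ) :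
    tExpect N b p β (fun σ => ∑ j ∈ s, f j σ) = ∑ j ∈ s, tExpect N b p β (f j) := by
  classical
  induction s using Finset.induction_on with
  | empty =>
    simp only [sum_empty]
    have := tExpect_const_mul hb p β 0 (fun _ : SpinConfig (TorusSite d (N * b)) => (1 : ℝ))
    simp only [zero_mul] at this
    exact this
  | insert j s hj ih => rw [sum_insert hj, ← ih, ← tExpect_add hb]; simp only [sum_insert hj]

end Model

/-! ### Reflection positivity through image hyperplanes -/

section RP

variable {N b : ℕ} [NeZero (N * b)]

variable (N b) in
/-- The reflection of the torus through the image hyperplanes `xᵢ = kb`, `xᵢ = kb + L/2`.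
[cite: FriedliVelenik2017, §10.3 (10.1)] -/
abbrev tRefl (i : Fin d) (k : ℤ) : TorusSite d (N * b) ≃ TorusSite d (N * b) :=
  Torus.reflectThroughSites i (((b : ℤ) * k : ℤ) : ZMod (N * b))

variable (N b) in
/-- The positive half-torus `𝕋₊ = {(xᵢ - kb).val ≤ L/2}` of the reflection `tRefl i k`.
[cite: FriedliVelenik2017, §10.3] -/
abbrev tHalf (i : Fin d) (k : ℤ) : Set (TorusSite d (N * b)) :=
  Torus.halfThroughSites i (((b : ℤ) * k : ℤ) : ZMod (N * b))

/-- **Reflection Cauchy–Schwarz for the pinned torus measure, Boltzmann-sum form.** For even `N`,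
`b ≥ 2`, a reflection `θ` through image hyperplanes and `𝕋₊`-local observables `f, g`:
`S(f · g∘θ)² ≤ S(f · f∘θ) · S(g · g∘θ)` for the Boltzmann sums over pinned configurations. The frozen
pattern is `θ`-invariant, so with `-βH = a + a∘θ` (`a` `𝕋₊`-local, Friedli–Velenik Example 10.9)
`S(F · G∘θ) = ∑_{all σ} u(σ) v(σ∘θ)` for `u = e^a F 𝟙₊`, `v = e^a G 𝟙₊`, `𝟙₊(σ) = [σ = pins on the
image sites of 𝕋₊]`; this bilinear form is symmetric and positive semidefinite on `𝕋₊`-local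
observables (Lemma 10.7), whence Cauchy–Schwarz.
[cite: FriedliVelenik2017, Lemma 10.7, Lemma 10.8, Example 10.9] -/
theorem tBsum_mul_comp_reflect_sq_le (hN : Even N) (hb : 2 ≤ b) (p : ℤˣ) (β : ℝ) (i : Fin d) (k : ℤ)
    {f g : SpinConfig (TorusSite d (N * b)) → ℝ}
    (hf : ∀ σ τ : SpinConfig (TorusSite d (N * b)), (∀ x ∈ tHalf N b i k, σ x = τ x) → f σ = f τ)
    (hg : ∀ σ τ : SpinConfig (TorusSite d (N * b)), (∀ x ∈ tHalf N b i k, σ x = τ x) → g σ = g τ) :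
    tBsum N b p β (fun σ => f σ * g (σ ∘ tRefl N b i k)) ^ 2 ≤
      tBsum N b p β (fun σ => f σ * f (σ ∘ tRefl N b i k)) * tBsum N b p β (fun σ => g σ * g (σ ∘ tRefl N b i k)) := by
  classical
  set θ := tRefl N b i k with hθdef
  set P := tHalf N b i k with hPdef
  set ζ := torusPin N b p with hζ
  have hL : Even (N * b) := even_mul_side hN b
  have hb0 : 0 < b := by omega
  have hθinv : Function.Involutive θ := Torus.reflectThroughSites_involutive i _
  have hθG : ∀ x y, (torusGraph d (N * b)).Adj x y → (torusGraph d (N * b)).Adj (θ x) (θ y) :=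
    fun _ _ hxy => Torus.torusGraph_adj_reflectThroughSites i _ hxy
  have H1 : ∀ x, x ∈ P ∨ θ x ∈ P := Torus.mem_halfThroughSites_or hL i _
  have H2 : ∀ x ∈ P, θ x ∈ P → θ x = x := fun _ hx hθx => Torus.reflectThroughSites_eq_self hL i _ hx hθx
  have H3 : ∀ x y, (torusGraph d (N * b)).Adj x y → (x ∈ P ∧ y ∈ P) ∨ (θ x ∈ P ∧ θ y ∈ P) :=
    fun _ _ hxy => Torus.torusGraph_adj_mem_halfThroughSites hL i _ hxy
  -- the frozen pattern and the image sites are `θ`-invariant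
  have hζθ : ∀ x, ¬ x ∈ tFree N b → ζ (θ x) = ζ x := by
    intro x hx
    rw [mem_tFree, not_not] at hx
    obtain ⟨y, rfl⟩ := hx
    exact torusPin_reflect hN hb0 p i k y
  have hIθ : ∀ x, x ∈ tFree N b ↔ θ x ∈ tFree N b := fun x => by
    rw [mem_tFree, mem_tFree, hθdef, tImg_reflect_iff]
  -- the half-space decomposition of `-βH`
  obtain ⟨a, ha_loc, ha_sum⟩ :=
    exists_neg_mul_isingHamiltonian_eq_add_comp (torusGraph d (N * b)) θ P hθinv hθG H1 H3 β 0
  -- the indicator of agreement with the pins on the image sites of `P`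
  let ind : SpinConfig (TorusSite d (N * b)) → ℝ := fun σ =>
    if ∀ x, x ∉ tFree N b → x ∈ P → σ x = ζ x then 1 else 0
  have hind_loc : ∀ σ τ : SpinConfig (TorusSite d (N * b)), (∀ x ∈ P, σ x = τ x) → ind σ = ind τ := by
    intro σ τ h
    simp only [ind]
    have : (∀ x, x ∉ tFree N b → x ∈ P → σ x = ζ x) ↔ (∀ x, x ∉ tFree N b → x ∈ P → τ x = ζ x) :=
      forall_congr' fun x => forall_congr' fun _ => forall_congr' fun hx => by rw [h x hx]
    by_cases h1 : ∀ x, x ∉ tFree N b → x ∈ P → σ x = ζ x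
    · rw [if_pos h1, if_pos (this.1 h1)]
    · rw [if_neg h1, if_neg (fun h2 => h1 (this.2 h2))]
  have hind_mul : ∀ σ : SpinConfig (TorusSite d (N * b)),
      ind σ * ind (σ ∘ θ) = if σ ∈ tOmega N b p then 1 else 0 := by
    intro σ
    have key : ((∀ x, x ∉ tFree N b → x ∈ P → σ x = ζ x) ∧ (∀ x, x ∉ tFree N b → x ∈ P → σ (θ x) = ζ x)) ↔
        σ ∈ tOmega N b p := by
      rw [mem_tOmega]
      constructor
      · rintro ⟨h1, h2⟩ x hx
        rcases H1 x with hxP | hxP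
        · exact h1 x hx hxP
        · have hθx : θ x ∉ tFree N b := fun h => hx ((hIθ x).2 h)
          have := h2 (θ x) hθx hxP
          rw [hθinv x] at this
          rw [this]; exact hζθ x hx
      · intro h
        refine ⟨fun x hx _ => h x hx, fun x hx _ => ?_⟩
        have hθx : θ x ∉ tFree N b := fun h' => hx ((hIθ x).2 h')
        rw [h (θ x) hθx]
        exact hζθ x hx
    by_cases hΩ : σ ∈ tOmega N b p
    · obtain ⟨h1, h2⟩ := key.2 hΩ
      simp only [ind, Function.comp_apply, if_pos h1, if_pos h2, if_pos hΩ, mul_one]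
    · rw [if_neg hΩ]
      simp only [ind, Function.comp_apply]
      by_cases h1 : ∀ x, x ∉ tFree N b → x ∈ P → σ x = ζ x
      · have h2 : ¬ ∀ x, x ∉ tFree N b → x ∈ P → σ (θ x) = ζ x := fun h2 => hΩ (key.1 ⟨h1, h2⟩)
        rw [if_neg h2, mul_zero]
      · rw [if_neg h1, zero_mul]
  -- the bilinear form and the key identity
  let B : (SpinConfig (TorusSite d (N * b)) → ℝ) → (SpinConfig (TorusSite d (N * b)) → ℝ) → ℝ :=
    fun u v => ∑ σ, u σ * v (σ ∘ θ)
  let lift : (SpinConfig (TorusSite d (N * b)) → ℝ) → SpinConfig (TorusSite d (N * b)) → ℝ :=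
    fun F σ => Real.exp (a σ) * F σ * ind σ
  have hkey : ∀ F G : SpinConfig (TorusSite d (N * b)) → ℝ,
      tBsum N b p β (fun σ => F σ * G (σ ∘ θ)) = B (lift F) (lift G) := by
    intro F G
    simp only [B, lift, tBsum]
    rw [← sum_filter_add_sum_filter_not univ (· ∈ tOmega N b p)]
    have hzero : ∑ σ ∈ univ.filter (fun σ => ¬ σ ∈ tOmega N b p),
        Real.exp (a σ) * F σ * ind σ * (Real.exp (a (σ ∘ θ)) * G (σ ∘ θ) * ind (σ ∘ θ)) = 0 := by
      refine sum_eq_zero fun σ hσ => ?_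
      have hσ' := (mem_filter.1 hσ).2
      have := hind_mul σ
      rw [if_neg hσ'] at this
      have : Real.exp (a σ) * F σ * ind σ * (Real.exp (a (σ ∘ θ)) * G (σ ∘ θ) * ind (σ ∘ θ)) =
          Real.exp (a σ) * F σ * (Real.exp (a (σ ∘ θ)) * G (σ ∘ θ)) * (ind σ * ind (σ ∘ θ)) := by ring
      rw [this, ‹ind σ * ind (σ ∘ θ) = 0›, mul_zero]
    rw [hzero, add_zero]
    have hfilter : (univ.filter (· ∈ tOmega N b p) : Finset (SpinConfig (TorusSite d (N * b)))) = tOmega N b p := by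
      ext σ; simp
    rw [hfilter]
    refine sum_congr rfl fun σ hσ => ?_
    have hi := hind_mul σ
    rw [if_pos hσ] at hi
    have hexp : Real.exp (-β * isingHamiltonian (torusGraph d (N * b)) univ 0 .free σ) =
        Real.exp (a σ) * Real.exp (a (σ ∘ θ)) := by rw [← Real.exp_add, ha_sum σ]
    rw [hexp]
    have : Real.exp (a σ) * F σ * ind σ * (Real.exp (a (σ ∘ θ)) * G (σ ∘ θ) * ind (σ ∘ θ)) =
        Real.exp (a σ) * Real.exp (a (σ ∘ θ)) * (F σ * G (σ ∘ θ)) * (ind σ * ind (σ ∘ θ)) := by ring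
    rw [this, hi, mul_one]
  -- locality of the lifted observables
  have hlift_loc : ∀ F : SpinConfig (TorusSite d (N * b)) → ℝ,
      (∀ σ τ : SpinConfig (TorusSite d (N * b)), (∀ x ∈ P, σ x = τ x) → F σ = F τ) →
      ∀ σ τ : SpinConfig (TorusSite d (N * b)), (∀ x ∈ P, σ x = τ x) → lift F σ = lift F τ := by
    intro F hF σ τ h
    simp only [lift, ha_loc σ τ h, hF σ τ h, hind_loc σ τ h]
  -- positive semidefiniteness (Friedli–Velenik Lemma 10.7) and symmetry
  have hpsd : ∀ w : SpinConfig (TorusSite d (N * b)) → ℝ,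
      (∀ σ τ : SpinConfig (TorusSite d (N * b)), (∀ x ∈ P, σ x = τ x) → w σ = w τ) → 0 ≤ B w w := by
    intro w hw
    have h := sum_conj_reflect_mul_re_nonneg θ hθinv P H1 H2 (fun σ => (w σ : ℂ))
      (fun σ τ hστ => by rw [hw σ τ hστ])
    have hre : (∑ σ : SpinConfig (TorusSite d (N * b)), conj ((w (σ ∘ θ) : ℝ) : ℂ) * ((w σ : ℝ) : ℂ)).re =
        ∑ σ, w σ * w (σ ∘ θ) := by
      rw [Complex.re_sum]
      refine sum_congr rfl fun σ _ => ?_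
      rw [Complex.conj_ofReal, ← Complex.ofReal_mul, Complex.ofReal_re, mul_comm]
    rw [hre] at h
    exact h
  have hsymm : ∀ u v : SpinConfig (TorusSite d (N * b)) → ℝ, B u v = B v u := by
    intro u v
    simp only [B]
    rw [← Equiv.sum_comp (configReflect θ) (fun σ => v σ * u (σ ∘ θ))]
    refine sum_congr rfl fun σ _ => ?_
    have h1 : (configReflect θ σ : SpinConfig (TorusSite d (N * b))) = σ ∘ θ := rfl
    have h2 : (σ ∘ θ) ∘ θ = σ := by funext x; simp [hθinv x]
    rw [h1, h2, mul_comm]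
  -- Cauchy–Schwarz from the discriminant
  set u := lift f
  set v := lift g
  have hu := hlift_loc f hf
  have hv := hlift_loc g hg
  have hquad : ∀ t : ℝ, 0 ≤ B v v * (t * t) + (-(2 * B u v)) * t + B u u := by
    intro t
    have hw : ∀ σ τ : SpinConfig (TorusSite d (N * b)), (∀ x ∈ P, σ x = τ x) →
        (fun σ => u σ - t * v σ) σ = (fun σ => u σ - t * v σ) τ := by
      intro σ τ h
      exact congrArg₂ (fun a c => a - t * c) (hu σ τ h) (hv σ τ h)
    have h := hpsd (fun σ => u σ - t * v σ) hw
    have hexp : B (fun σ => u σ - t * v σ) (fun σ => u σ - t * v σ) =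
        B u u - t * (B u v + B v u) + t * t * B v v := by
      simp only [B]
      have hpt : ∀ σ : SpinConfig (TorusSite d (N * b)), (u σ - t * v σ) * (u (σ ∘ θ) - t * v (σ ∘ θ)) =
          u σ * u (σ ∘ θ) - t * (u σ * v (σ ∘ θ) + v σ * u (σ ∘ θ)) + t * t * (v σ * v (σ ∘ θ)) :=
        fun σ => by ring
      rw [sum_congr rfl fun σ _ => hpt σ, sum_add_distrib, sum_sub_distrib, ← mul_sum, ← mul_sum,
        sum_add_distrib]
    rw [hexp, hsymm v u] at h
    nlinarith
  have hdisc := discrim_le_zero hquad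
  rw [discrim] at hdisc
  rw [hkey f g, hkey f f, hkey g g]
  nlinarith

/-- **Reflection Cauchy–Schwarz for the pinned torus measure** (`N` even, `b ≥ 2`):
`⟨f · g∘θ⟩² ≤ ⟨f · f∘θ⟩ ⟨g · g∘θ⟩` for `𝕋₊`-local `f, g` and the reflection `θ` through image
hyperplanes — reflection positivity of the internal-spin system with the (reflection-symmetric)
frozen alternating image spins. [cite: FriedliVelenik2017, Lemma 10.7, Lemma 10.8, Example 10.9] -/
theorem tExpect_mul_comp_reflect_sq_le (hN : Even N) (hb : 2 ≤ b) (p : ℤˣ) (β : ℝ) (i : Fin d) (k : ℤ)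
    {f g : SpinConfig (TorusSite d (N * b)) → ℝ}
    (hf : ∀ σ τ : SpinConfig (TorusSite d (N * b)), (∀ x ∈ tHalf N b i k, σ x = τ x) → f σ = f τ)
    (hg : ∀ σ τ : SpinConfig (TorusSite d (N * b)), (∀ x ∈ tHalf N b i k, σ x = τ x) → g σ = g τ) :
    tExpect N b p β (fun σ => f σ * g (σ ∘ tRefl N b i k)) ^ 2 ≤
      tExpect N b p β (fun σ => f σ * f (σ ∘ tRefl N b i k)) *
        tExpect N b p β (fun σ => g σ * g (σ ∘ tRefl N b i k)) := by
  have h := tBsum_mul_comp_reflect_sq_le hN hb p β i k hf hg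
  have hZ := tBsum_one_pos (d := d) (N := N) (b := b) p β
  simp only [tExpect_eq_tBsum_div hb]
  rw [div_pow, div_mul_div_comm, ← sq]
  exact div_le_div_of_nonneg_right h (sq_nonneg _)

end RP

/-! ### Cells of the image lattice and bad cells -/

section Cells

variable {N b : ℕ}

variable (b) in
/-- **The closed cell** `[cb, cb + b]^d ⊂ ℤ^d` of the image lattice with lower corner `b·c`
(its `2^d` corners are image sites). [cite: FriedliVelenik2017, §10.2 (the blocks Λ_B + tB)] -/
def cellZ (c : Site d) : Finset (Site d) :=
  Finset.Icc (fun i => (b : ℤ) * c i) (fun i => (b : ℤ) * c i + b)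

/-- Membership in a cell. [cite: FriedliVelenik2017, §10.2] -/
theorem mem_cellZ {c y : Site d} : y ∈ cellZ b c ↔ ∀ i, (b : ℤ) * c i ≤ y i ∧ y i ≤ (b : ℤ) * c i + b := by
  rw [cellZ, Finset.mem_Icc, Pi.le_def, Pi.le_def]
  exact ⟨fun h i => ⟨h.1 i, h.2 i⟩, fun h => ⟨fun i => (h i).1, fun i => (h i).2⟩⟩

variable (b) in
/-- The internal sites of a cell. [cite: VanenterFernandezSokal1993, §4.3.2] -/
def freeCellZ (c : Site d) : Finset (Site d) := (cellZ b c).filter fun y => ¬ IsSpImageSite d b y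

/-- Membership in `freeCellZ`. [cite: VanenterFernandezSokal1993, §4.3.2] -/
theorem mem_freeCellZ {c y : Site d} : y ∈ freeCellZ b c ↔ y ∈ cellZ b c ∧ ¬ IsSpImageSite d b y := by
  rw [freeCellZ, mem_filter]

variable (N b) in
/-- **Bad cells**: the cell `c` is BAD for the torus configuration `σ` if `σ` is not constant on the
(projections of the) internal sites of the cell — the "bad block" event of the chessboard–Peierls
argument (Friedli–Velenik §10.4.2; Fröhlich–Lieb 1978). [cite: FriedliVelenik2017, §10.4.2] -/
def BadCell (c : Site d) (σ : SpinConfig (TorusSite d (N * b))) : Prop :=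
  ∃ u ∈ freeCellZ b c, ∃ v ∈ freeCellZ b c, σ (Torus.proj (N * b) u) ≠ σ (Torus.proj (N * b) v)

variable (N b) in
/-- The indicator of a bad cell. [cite: FriedliVelenik2017, §10.4.2] -/
def badInd (c : Site d) (σ : SpinConfig (TorusSite d (N * b))) : ℝ :=
  open Classical in if BadCell N b c σ then 1 else 0

/-- `badInd` is nonnegative. [folklore] -/
theorem badInd_nonneg (c : Site d) (σ : SpinConfig (TorusSite d (N * b))) : 0 ≤ badInd N b c σ := by
  unfold badInd; split_ifs <;> norm_num

/-- `badInd` is at most one. [folklore] -/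
theorem badInd_le_one (c : Site d) (σ : SpinConfig (TorusSite d (N * b))) : badInd N b c σ ≤ 1 := by
  unfold badInd; split_ifs <;> norm_num

/-- **Locality of badness**: `BadCell c` only depends on the spins at the projected internal sites of
the cell. [cite: FriedliVelenik2017, §10.4.2] -/
theorem badCell_congr {c : Site d} {σ τ : SpinConfig (TorusSite d (N * b))}
    (h : ∀ y ∈ freeCellZ b c, σ (Torus.proj (N * b) y) = τ (Torus.proj (N * b) y)) :
    BadCell N b c σ ↔ BadCell N b c τ := by
  unfold BadCell
  constructor
  · rintro ⟨u, hu, v, hv, huv⟩; exact ⟨u, hu, v, hv, by rwa [← h u hu, ← h v hv]⟩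
  · rintro ⟨u, hu, v, hv, huv⟩; exact ⟨u, hu, v, hv, by rwa [h u hu, h v hv]⟩

/-- `badInd` only depends on the spins at the projected internal sites of the cell.
[cite: FriedliVelenik2017, §10.4.2] -/
theorem badInd_congr {c : Site d} {σ τ : SpinConfig (TorusSite d (N * b))}
    (h : ∀ y ∈ freeCellZ b c, σ (Torus.proj (N * b) y) = τ (Torus.proj (N * b) y)) :
    badInd N b c σ = badInd N b c τ := by
  unfold badInd; rw [badCell_congr h]

/-- A map of `ℤ^d` commuting with the projection up to `σ` and mapping the internal sites of the
cell `c` onto those of the cell `c'` transports badness. [folklore] -/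
theorem badCell_iff_of_maps {c c' : Site d} (T : Site d → Site d) (hT : ∀ y ∈ freeCellZ b c, T y ∈ freeCellZ b c')
    (hT' : ∀ y' ∈ freeCellZ b c', ∃ y ∈ freeCellZ b c, T y = y')
    {σ σ' : SpinConfig (TorusSite d (N * b))}
    (hσ : ∀ y ∈ freeCellZ b c, σ (Torus.proj (N * b) y) = σ' (Torus.proj (N * b) (T y))) :
    BadCell N b c σ ↔ BadCell N b c' σ' := by
  unfold BadCell
  constructor
  · rintro ⟨u, hu, v, hv, huv⟩
    exact ⟨T u, hT u hu, T v, hT v hv, by rwa [← hσ u hu, ← hσ v hv]⟩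
  · rintro ⟨u', hu', v', hv', huv⟩
    obtain ⟨u, hu, rfl⟩ := hT' u' hu'
    obtain ⟨v, hv, rfl⟩ := hT' v' hv'
    exact ⟨u, hu, v, hv, by rwa [hσ u hu, hσ v hv]⟩

/-- Translating by `b·v` maps cells to cells. [folklore] -/
theorem add_mem_cellZ {c y : Site d} (v : Site d) (hy : y ∈ cellZ b c) :
    (y + fun i => (b : ℤ) * v i) ∈ cellZ b (c + v) := by
  rw [mem_cellZ] at hy ⊢
  intro i
  have := hy i
  simp only [Pi.add_apply]
  constructor <;> nlinarith

/-- Translating by `b·v` preserves image sites. [folklore] -/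
theorem isSpImageSite_add_iff (y v : Site d) :
    IsSpImageSite d b (y + fun i => (b : ℤ) * v i) ↔ IsSpImageSite d b y := by
  refine forall_congr' fun i => ?_
  simp only [Pi.add_apply]
  constructor
  · intro hy; simpa using dvd_sub hy (dvd_mul_right (b : ℤ) (v i))
  · intro hy; exact dvd_add hy (dvd_mul_right _ _)

/-- Translating by `b·v` maps internal cell sites to internal cell sites. [folklore] -/
theorem add_mem_freeCellZ {c y : Site d} (v : Site d) (hy : y ∈ freeCellZ b c) :
    (y + fun i => (b : ℤ) * v i) ∈ freeCellZ b (c + v) := by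
  rw [mem_freeCellZ] at hy ⊢
  exact ⟨add_mem_cellZ v hy.1, fun h => hy.2 ((isSpImageSite_add_iff y v).1 h)⟩

/-- **Periodicity of badness**: cells whose lower corners differ by an element of `Nℤ^d` project to
the same cell of the torus. [cite: FriedliVelenik2017, §10.2] -/
theorem badCell_iff_of_dvd {c c' : Site d} (h : ∀ i, (N : ℤ) ∣ c' i - c i) (σ : SpinConfig (TorusSite d (N * b))) :
    BadCell N b c σ ↔ BadCell N b c' σ := by
  choose w hw using h
  have hproj : ∀ y : Site d, Torus.proj (N * b) (y + fun i => (b : ℤ) * (c' - c) i) = Torus.proj (N * b) y := by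
    intro y
    funext i
    simp only [Torus.proj, Pi.add_apply, Pi.sub_apply, hw i]
    push_cast
    rw [add_eq_left, show (b : ZMod (N * b)) * ((N : ZMod (N * b)) * (w i : ZMod (N * b))) =
      ((N * b : ℕ) : ZMod (N * b)) * (w i : ZMod (N * b)) by push_cast; ring, ZMod.natCast_self, zero_mul]
  refine badCell_iff_of_maps (fun y => y + fun i => (b : ℤ) * (c' - c) i) (fun y hy => ?_) (fun y' hy' => ?_)
    (fun y _ => by rw [hproj])
  · have := add_mem_freeCellZ (c' - c) hy
    rwa [add_sub_cancel] at this
  · refine ⟨y' + fun i => (b : ℤ) * (c - c') i, ?_, ?_⟩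
    · have := add_mem_freeCellZ (c - c') hy'
      rwa [add_sub_cancel] at this
    · funext i
      simp only [Pi.add_apply, Pi.sub_apply]
      ring

/-- The projection intertwines the reflection of `ℤ^d` through `yᵢ = bk` with the torus reflection
through the image hyperplanes `xᵢ = kb`, `kb + L/2`. [cite: FriedliVelenik2017, §10.3 (10.1)] -/
theorem tRefl_proj [NeZero (N * b)] (i : Fin d) (k : ℤ) (y : Site d) :
    tRefl N b i k (Torus.proj (N * b) y) = Torus.proj (N * b) (Function.update y i (2 * b * k - y i)) := by
  funext j
  by_cases hj : j = i
  · subst hj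
    simp only [Torus.reflectThroughSites_apply, Function.update_self, Torus.proj]
    push_cast; ring
  · simp [Torus.reflectThroughSites_apply, hj, Torus.proj]

/-- **Badness transforms under the reflection through image hyperplanes as the block reflection
`c ↦ c[i ↦ 2k - 1 - cᵢ]`.** [cite: FriedliVelenik2017, §10.2 (Θ acting on blocks)] -/
theorem badCell_comp_tRefl [NeZero (N * b)] (i : Fin d) (k : ℤ) (c : Site d) (σ : SpinConfig (TorusSite d (N * b))) :
    BadCell N b c (σ ∘ tRefl N b i k) ↔ BadCell N b (Function.update c i (2 * k - 1 - c i)) σ := by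
  set R : Site d → Site d := fun y => Function.update y i (2 * b * k - y i) with hR
  have hRR : ∀ y, R (R y) = y := fun y => by
    simp only [hR]; ext j; by_cases hj : j = i
    · subst hj; simp
    · simp [hj]
  have hRcell : ∀ (c : Site d) (y : Site d), y ∈ cellZ b c → R y ∈ cellZ b (Function.update c i (2 * k - 1 - c i)) := by
    intro c y hy
    rw [mem_cellZ] at hy ⊢
    intro j
    by_cases hj : j = i
    · subst hj
      simp only [hR, Function.update_self]
      have := hy j
      constructor <;> nlinarith
    · simp only [hR, Function.update_of_ne hj]
      exact hy j
  have hRimg : ∀ y, IsSpImageSite d b y ↔ IsSpImageSite d b (R y) := by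
    intro y
    constructor
    · intro h j
      by_cases hj : j = i
      · subst hj; simp only [hR, Function.update_self]
        exact dvd_sub ⟨2 * k, by ring⟩ (h j)
      · simp only [hR, Function.update_of_ne hj]; exact h j
    · intro h j
      by_cases hj : j = i
      · subst hj
        have := h j
        simp only [hR, Function.update_self] at this
        have h2 : (b : ℤ) ∣ 2 * b * k := ⟨2 * k, by ring⟩
        simpa using dvd_sub h2 this
      · have := h j
        simp only [hR, Function.update_of_ne hj] at this
        exact this
  have hcc : Function.update (Function.update c i (2 * k - 1 - c i)) i
      (2 * k - 1 - Function.update c i (2 * k - 1 - c i) i) = c := by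
    ext j; by_cases hj : j = i
    · subst hj; simp
    · simp [hj]
  refine badCell_iff_of_maps R (fun y hy => ?_) (fun y' hy' => ?_) (fun y _ => ?_)
  · rw [mem_freeCellZ] at hy ⊢
    exact ⟨hRcell c y hy.1, fun h => hy.2 ((hRimg y).2 h)⟩
  · rw [mem_freeCellZ] at hy'
    refine ⟨R y', mem_freeCellZ.2 ⟨?_, fun h => hy'.2 ((hRimg y').2 h)⟩, hRR y'⟩
    have := hRcell _ y' hy'.1
    rwa [hcc] at this
  · show σ (tRefl N b i k (Torus.proj (N * b) y)) = σ (Torus.proj (N * b) (R y))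
    rw [tRefl_proj]

end Cells

/-! ## The chessboard estimate for bad cells -/

section ChessboardCells

variable {N b : ℕ}

/-! ### Lifting cell indices -/

/-- The lower corner in `ℤ^d` (coordinates in `{0, …, N-1}`) of a cell index of the block torus.
[cite: FriedliVelenik2017, §10.2] -/
def liftIdx (c : BlockIdx d N) : Site d := fun i => ((c i).val : ℤ)

/-- The representative of an integer mod `N` differs from it by a multiple of `N`. [folklore] -/
theorem dvd_val_intCast_sub [NeZero N] (a : ℤ) : (N : ℤ) ∣ (((a : ZMod N)).val : ℤ) - a := by
  rw [ZMod.val_intCast, Int.emod_def]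
  exact ⟨-(a / N), by ring⟩

/-- `liftIdx` of a cell index is congruent to any integer vector casting to it. [folklore] -/
theorem dvd_liftIdx_sub [NeZero N] (c : Site d) (i : Fin d) :
    (N : ℤ) ∣ liftIdx (fun j => (c j : ZMod N)) i - c i :=
  dvd_val_intCast_sub (c i)

/-- The projection of `liftIdx c̄` back to the block torus is `c̄`. [folklore] -/
theorem intCast_liftIdx [NeZero N] (c : BlockIdx d N) (i : Fin d) : ((liftIdx c i : ℤ) : ZMod N) = c i := by
  simp [liftIdx]

variable (N b) in
/-- The indicator that the cell of index `c̄` of the torus `(ℤ/Nbℤ)^d` is bad. [cite: FriedliVelenik2017, §10.4.2] -/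
def badIdx (c : BlockIdx d N) (σ : SpinConfig (TorusSite d (N * b))) : ℝ := badInd N b (liftIdx c) σ

variable (N b) in
/-- The product of bad-cell indicators over a set of cells: the indicator that all of them are bad.
[cite: FriedliVelenik2017, §10.4.2] -/
def prodBad (S : Finset (BlockIdx d N)) (σ : SpinConfig (TorusSite d (N * b))) : ℝ := ∏ c ∈ S, badIdx N b c σ

/-- `prodBad` is nonnegative. [folklore] -/
theorem prodBad_nonneg (S : Finset (BlockIdx d N)) (σ : SpinConfig (TorusSite d (N * b))) : 0 ≤ prodBad N b S σ :=
  prod_nonneg fun _ _ => badInd_nonneg _ σ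

/-- `prodBad` is at most one. [folklore] -/
theorem prodBad_le_one (S : Finset (BlockIdx d N)) (σ : SpinConfig (TorusSite d (N * b))) : prodBad N b S σ ≤ 1 :=
  prod_le_one (fun _ _ => badInd_nonneg _ σ) fun _ _ => badInd_le_one _ σ

/-- Cells with congruent lower corners have the same indicator (periodicity). [cite: FriedliVelenik2017, §10.2] -/
theorem badInd_eq_of_dvd {c c' : Site d} (h : ∀ i, (N : ℤ) ∣ c' i - c i) (σ : SpinConfig (TorusSite d (N * b))) :
    badInd N b c σ = badInd N b c' σ := by
  unfold badInd; rw [badCell_iff_of_dvd h]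

/-- `badIdx` of the projection of an integer corner is `badInd` of that corner. [cite: FriedliVelenik2017, §10.2] -/
theorem badIdx_intCast [NeZero N] (c : Site d) (σ : SpinConfig (TorusSite d (N * b))) :
    badIdx N b (fun j => (c j : ZMod N)) σ = badInd N b c σ :=
  (badInd_eq_of_dvd (fun i => dvd_liftIdx_sub c i) σ).symm

/-! ### Transformation under reflections and locality -/

/-- **Bad-cell indicators transform under the reflection through image hyperplanes as the block
reflection of the cell index.** [cite: FriedliVelenik2017, §10.2 (Θ acting on blocks)] -/
theorem badIdx_comp_tRefl [NeZero N] [NeZero (N * b)] (i : Fin d) (k : ZMod N) (c : BlockIdx d N)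
    (σ : SpinConfig (TorusSite d (N * b))) :
    badIdx N b c (σ ∘ tRefl N b i (k.val : ℤ)) = badIdx N b (cellReflect i k c) σ := by
  unfold badIdx badInd
  rw [badCell_comp_tRefl]
  rw [badCell_iff_of_dvd (c' := liftIdx (cellReflect i k c)) (fun j => ?_)]
  by_cases hj : j = i
  · subst hj
    simp only [Function.update_self, liftIdx, cellReflect_apply]
    have h := dvd_val_intCast_sub (N := N) (2 * (k.val : ℤ) - 1 - ((c j).val : ℤ))
    have hc : ((2 * (k.val : ℤ) - 1 - ((c j).val : ℤ) : ℤ) : ZMod N) = 2 * k - 1 - c j := by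
      push_cast; simp
    rwa [hc] at h
  · simp [liftIdx, cellReflect_apply, hj]

/-- For `N = m + m` the half side of the torus is `m·b`. [folklore] -/
theorem mul_side_div_two {m : ℕ} (hN : N = m + m) : N * b / 2 = m * b := by
  subst hN; rw [show (m + m) * b = m * b * 2 by ring, Nat.mul_div_cancel _ two_pos]

/-- **Cells of the positive half of the block torus lie in the positive half-torus**: for
`(c̄ᵢ - k).val < N/2`, every site of the cell `liftIdx c̄` projects into `𝕋₊ = {(xᵢ - kb).val ≤ L/2}`.
[cite: FriedliVelenik2017, §10.3] -/
theorem proj_mem_tHalf_of_mem_halfPlus [NeZero N] [NeZero (N * b)] (hN : Even N) {i : Fin d} {k : ZMod N}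
    {c : BlockIdx d N} (hc : c ∈ halfPlus N i k) {y : Site d} (hy : y ∈ cellZ b (liftIdx c)) :
    Torus.proj (N * b) y ∈ tHalf N b i (k.val : ℤ) := by
  obtain ⟨m, hm⟩ := hN
  rw [mem_halfPlus] at hc
  have hNb : (0 : ℤ) < (N * b : ℕ) := by exact_mod_cast Nat.pos_of_ne_zero (NeZero.ne (N * b))
  have hN0 : 0 < N := Nat.pos_of_ne_zero (NeZero.ne N)
  -- integer bookkeeping
  set cz : ℤ := ((c i).val : ℤ) with hcz
  set kz : ℤ := (k.val : ℤ) with hkz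
  have hval : (((c i - k : ZMod N)).val : ℤ) = (cz - kz) % N := by
    have : (c i - k : ZMod N) = ((cz - kz : ℤ) : ZMod N) := by
      simp [hcz, hkz]
    rw [this, ZMod.val_intCast]
  have hj : (cz - kz) % N < (N / 2 : ℕ) := by
    have : (((c i - k : ZMod N)).val : ℤ) < (N / 2 : ℕ) := by exact_mod_cast hc
    rwa [hval] at this
  set j : ℤ := (cz - kz) % N with hjdef
  set t : ℤ := (cz - kz) / N with htdef
  have hdecomp : cz - kz = N * t + j := by
    have := Int.emod_add_mul_ediv (cz - kz) N
    rw [← hjdef, ← htdef] at this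
    linarith
  have hj0 : 0 ≤ j := Int.emod_nonneg _ (by exact_mod_cast hN0.ne')
  obtain ⟨hy1, hy2⟩ := (mem_cellZ.1 hy) i
  simp only [liftIdx] at hy1 hy2
  rw [← hcz] at hy1 hy2
  -- the representative of `yᵢ - b k`
  have hm2 : (N / 2 : ℕ) = m := by omega
  rw [hm2] at hj
  have hrepr : y i - b * kz = (N * b : ℕ) * t + (y i - b * cz + b * j) := by
    push_cast
    have : y i - (b : ℤ) * kz = b * (cz - kz) + (y i - b * cz) := by ring
    rw [this, hdecomp]; ring
  have hb0 : 0 < b := Nat.pos_of_ne_zero fun h => NeZero.ne (N * b) (by simp [h])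
  have hm0 : 0 < m := by omega
  have hbm : (0 : ℤ) < (b : ℤ) * (m : ℤ) := by positivity
  have hNb' : ((N * b : ℕ) : ℤ) = 2 * ((b : ℤ) * (m : ℤ)) := by push_cast; rw [hm]; push_cast; ring
  have hlt : y i - b * cz + b * j < (N * b : ℕ) := by
    have : (b : ℤ) * j ≤ b * (m - 1) := mul_le_mul_of_nonneg_left (by omega) (by positivity)
    rw [hNb']
    nlinarith
  have hge : 0 ≤ y i - b * cz + b * j := by positivity
  show ((Torus.proj (N * b) y) i - (((b : ℤ) * (k.val : ℤ) : ℤ) : ZMod (N * b))).val ≤ N * b / 2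
  have hcast : (Torus.proj (N * b) y) i - (((b : ℤ) * (k.val : ℤ) : ℤ) : ZMod (N * b)) =
      ((y i - b * kz : ℤ) : ZMod (N * b)) := by
    simp [Torus.proj, hkz]
  rw [hcast]
  have hv : ((((y i - b * kz : ℤ) : ZMod (N * b))).val : ℤ) = y i - b * cz + b * j := by
    rw [ZMod.val_intCast, hrepr, add_comm, Int.add_mul_emod_self_left, Int.emod_eq_of_lt hge hlt]
  have hfin : ((((y i - b * kz : ℤ) : ZMod (N * b))).val : ℤ) ≤ (N * b / 2 : ℕ) := by
    rw [hv, mul_side_div_two hm]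
    push_cast
    have : (b : ℤ) * j ≤ b * (m - 1) := mul_le_mul_of_nonneg_left (by omega) (by positivity)
    nlinarith
  exact_mod_cast hfin

/-- **Locality of bad cells**: for a cell of the positive half, `badIdx c̄` only depends on the spins
in the positive half-torus. [cite: FriedliVelenik2017, §10.3] -/
theorem badIdx_local [NeZero N] [NeZero (N * b)] (hN : Even N) {i : Fin d} {k : ZMod N} {c : BlockIdx d N}
    (hc : c ∈ halfPlus N i k) {σ τ : SpinConfig (TorusSite d (N * b))}
    (h : ∀ x ∈ tHalf N b i (k.val : ℤ), σ x = τ x) : badIdx N b c σ = badIdx N b c τ :=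
  badInd_congr fun _ hy => h _ (proj_mem_tHalf_of_mem_halfPlus hN hc (mem_freeCellZ.1 hy).1)

/-- Locality of products of bad-cell indicators over cells of the positive half.
[cite: FriedliVelenik2017, §10.3] -/
theorem prodBad_local [NeZero N] [NeZero (N * b)] (hN : Even N) {i : Fin d} {k : ZMod N}
    {S : Finset (BlockIdx d N)} (hS : S ⊆ halfPlus N i k) {σ τ : SpinConfig (TorusSite d (N * b))}
    (h : ∀ x ∈ tHalf N b i (k.val : ℤ), σ x = τ x) : prodBad N b S σ = prodBad N b S τ :=
  prod_congr rfl fun _ hc => badIdx_local hN (hS hc) h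

/-! ### The reflection Cauchy–Schwarz inequality for `ψ(S) = ⟨prodBad S⟩` -/

/-- **`ψ(S)² ≤ ψ(symP S) ψ(symM S)`** for `ψ(S) = ⟨∏_{c̄ ∈ S} badIdx c̄⟩`: reflection positivity of the
pinned torus measure applied to `F = ∏_{S ∩ H₊} badIdx`, `G = ∏_{θ(S ∩ H₋)} badIdx`.
[cite: FriedliVelenik2017, Theorem 10.11 (proof)] -/
theorem tExpect_prodBad_sq_le [NeZero N] [NeZero (N * b)] (hN : Even N) (hb : 2 ≤ b) (p : ℤˣ) (β : ℝ)
    (i : Fin d) (k : ZMod N) (S : Finset (BlockIdx d N)) :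
    tExpect N b p β (prodBad N b S) ^ 2 ≤
      tExpect N b p β (prodBad N b (symP i k S)) * tExpect N b p β (prodBad N b (symM i k S)) := by
  classical
  set θ := tRefl N b i (k.val : ℤ) with hθ
  set ρ := cellReflect i k with hρ
  set Sp := S ∩ halfPlus N i k with hSp
  set Sm := S ∩ halfMinus N i k with hSm
  set f : SpinConfig (TorusSite d (N * b)) → ℝ := prodBad N b Sp with hf
  set g : SpinConfig (TorusSite d (N * b)) → ℝ := prodBad N b (Sm.image ρ) with hg
  have hρinj : Function.Injective ρ := (cellReflect i k).injective
  have hρρ : ∀ c, ρ (ρ c) = c := cellReflect_cellReflect i k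
  -- products transported by `θ`
  have hcomp : ∀ (T : Finset (BlockIdx d N)) (σ : SpinConfig (TorusSite d (N * b))),
      prodBad N b T (σ ∘ θ) = prodBad N b (T.image ρ) σ := by
    intro T σ
    rw [prodBad, prodBad, prod_image fun c _ c' _ h => hρinj h]
    exact prod_congr rfl fun c _ => badIdx_comp_tRefl i k c σ
  have himage_image : ∀ T : Finset (BlockIdx d N), (T.image ρ).image ρ = T := by
    intro T; rw [image_image]; convert image_id (s := T) using 2; funext c; exact hρρ c
  -- disjointness of the pieces
  have hdisjS : Disjoint Sp Sm :=
    (disjoint_halfPlus_halfMinus i k).mono inter_subset_right inter_subset_right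
  have hdisjP : Disjoint Sp (Sp.image ρ) := by
    rw [Finset.disjoint_left]
    rintro c hc hc'
    obtain ⟨c₀, hc₀, rfl⟩ := mem_image.1 hc'
    exact Finset.disjoint_left.1 (disjoint_halfPlus_halfMinus i k) (mem_inter.1 hc).2
      (cellReflect_mem_halfMinus hN (mem_inter.1 hc₀).2)
  have hdisjM : Disjoint Sm (Sm.image ρ) := by
    rw [Finset.disjoint_left]
    rintro c hc hc'
    obtain ⟨c₀, hc₀, rfl⟩ := mem_image.1 hc'
    exact Finset.disjoint_left.1 (disjoint_halfPlus_halfMinus i k)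
      (cellReflect_mem_halfPlus hN (mem_inter.1 hc₀).2) (mem_inter.1 hc).2
  have hSunion : Sp ∪ Sm = S := by
    rw [hSp, hSm, ← inter_union_distrib_left]
    exact inter_eq_left.2 fun c _ => mem_union.2 (mem_halfPlus_or_mem_halfMinus i k c)
  -- the three identities
  have h1 : (fun σ => f σ * g (σ ∘ θ)) = prodBad N b S := by
    funext σ
    rw [hg, hcomp, himage_image, hf, prodBad, prodBad, ← prod_union hdisjS, hSunion, prodBad]
  have h2 : (fun σ => f σ * f (σ ∘ θ)) = prodBad N b (symP i k S) := by
    funext σ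
    rw [hf, hcomp, prodBad, prodBad, ← prod_union hdisjP, symP, prodBad]
  have h3 : (fun σ => g σ * g (σ ∘ θ)) = prodBad N b (symM i k S) := by
    funext σ
    rw [hg, hcomp, himage_image, prodBad, prodBad, mul_comm, ← prod_union hdisjM, symM, prodBad]
  -- locality
  have hfloc : ∀ σ τ : SpinConfig (TorusSite d (N * b)), (∀ x ∈ tHalf N b i (k.val : ℤ), σ x = τ x) → f σ = f τ :=
    fun σ τ h => prodBad_local hN inter_subset_right h
  have hgloc : ∀ σ τ : SpinConfig (TorusSite d (N * b)), (∀ x ∈ tHalf N b i (k.val : ℤ), σ x = τ x) → g σ = g τ := by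
    intro σ τ h
    refine prodBad_local hN (fun c hc => ?_) h
    obtain ⟨c₀, hc₀, rfl⟩ := mem_image.1 hc
    exact cellReflect_mem_halfPlus hN (mem_inter.1 hc₀).2
  have key := tExpect_mul_comp_reflect_sq_le hN hb p β i (k.val : ℤ) hfloc hgloc
  rwa [h1, h2, h3] at key

/-! ### An all-bad pinned configuration -/

/-- For even `L`, consecutive residues have representatives of opposite parities. [folklore] -/
theorem even_val_add_one_iff {L : ℕ} [NeZero L] (hL : Even L) (w : ZMod L) : Even (w + 1).val ↔ ¬ Even w.val := by
  obtain ⟨m, hm⟩ := hL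
  have hL0 : 0 < L := Nat.pos_of_ne_zero (NeZero.ne L)
  have hL2 : 1 < L := by omega
  have h1 : (1 : ZMod L).val = 1 := by rw [← Nat.cast_one, ZMod.val_natCast, Nat.mod_eq_of_lt hL2]
  have hw := ZMod.val_lt w
  have hw1 := ZMod.val_lt (w + 1)
  rcases zmod_val_add_eq_or (rfl : w + 1 = w + 1) with h | h <;> rw [h1] at h
  · rw [← h, Nat.even_add_one]
  · have h0 : (w + 1).val = 0 := by omega
    have hwv : w.val = m + (m - 1) := by omega
    have hm1 : 1 ≤ m := by omega
    rw [h0, hwv]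
    exact ⟨fun _ => fun ⟨r, hr⟩ => by omega, fun _ => ⟨0, rfl⟩⟩

/-- **An all-bad pinned configuration**: frozen pattern at the image sites and the parity of the
representative of the first coordinate at internal sites. Every cell contains the internal sites
`bc + e₀ + e₁` and `bc + 2e₀ + e₁`, whose first coordinates have representatives of opposite parities
(`L` even). [cite: FriedliVelenik2017, Theorem 10.11 (the universal contour has positive weight)] -/
theorem exists_forall_badCell [NeZero (N * b)] (hd : 2 ≤ d) (hN : Even N) (hb : 2 ≤ b) (p : ℤˣ) :
    ∃ σ ∈ tOmega N b p, ∀ c : Site d, BadCell N b c σ := by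
  classical
  set i₀ : Fin d := ⟨0, by omega⟩
  set i₁ : Fin d := ⟨1, by omega⟩
  have h01 : i₀ ≠ i₁ := by simp [i₀, i₁, Fin.ext_iff]
  have hL : Even (N * b) := even_mul_side hN b
  let σ : SpinConfig (TorusSite d (N * b)) := fun x =>
    if TImg N b x then torusPin N b p x else if Even (x i₀).val then 1 else -1
  refine ⟨σ, mem_tOmega.2 fun x hx => ?_, fun c => ?_⟩
  · rw [mem_tFree, not_not] at hx
    simp only [σ, if_pos hx]
  · -- the two internal sites
    let u : Site d := fun j => (b : ℤ) * c j + if j = i₀ ∨ j = i₁ then 1 else 0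
    let v : Site d := fun j => (b : ℤ) * c j + if j = i₀ then 2 else if j = i₁ then 1 else 0
    have hbz : (2 : ℤ) ≤ b := by exact_mod_cast hb
    have hu : u ∈ freeCellZ b c := by
      refine mem_freeCellZ.2 ⟨mem_cellZ.2 fun j => ?_, fun h => ?_⟩
      · simp only [u]; split_ifs <;> constructor <;> linarith
      · have := h i₀
        simp only [u, true_or, if_true] at this
        have h1 : (b : ℤ) ∣ 1 := by simpa using dvd_sub this (dvd_mul_right (b : ℤ) (c i₀))
        have := Int.le_of_dvd one_pos h1
        omega
    have hv : v ∈ freeCellZ b c := by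
      refine mem_freeCellZ.2 ⟨mem_cellZ.2 fun j => ?_, fun h => ?_⟩
      · simp only [v]; split_ifs <;> constructor <;> linarith
      · have := h i₁
        simp only [v, h01.symm, if_false, if_true] at this
        have h1 : (b : ℤ) ∣ 1 := by simpa using dvd_sub this (dvd_mul_right (b : ℤ) (c i₁))
        have := Int.le_of_dvd one_pos h1
        omega
    have huimg : ¬ TImg N b (Torus.proj (N * b) u) := fun h => (mem_freeCellZ.1 hu).2 (tImg_proj_iff.1 h)
    have hvimg : ¬ TImg N b (Torus.proj (N * b) v) := fun h => (mem_freeCellZ.1 hv).2 (tImg_proj_iff.1 h)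
    refine ⟨u, hu, v, hv, ?_⟩
    simp only [σ, if_neg huimg, if_neg hvimg]
    have hcoord : (Torus.proj (N * b) v) i₀ = (Torus.proj (N * b) u) i₀ + 1 := by
      simp only [Torus.proj, u, v, true_or, if_true]
      push_cast; ring
    rw [hcoord]
    by_cases he : Even ((Torus.proj (N * b) u) i₀).val
    · rw [if_pos he, if_neg ((even_val_add_one_iff hL _).not.2 (not_not.2 he))]; decide
    · rw [if_neg he, if_pos ((even_val_add_one_iff hL _).2 he)]; decide

/-- **The probability that all cells are bad is positive** (the all-bad configuration has positive
Boltzmann weight). [cite: FriedliVelenik2017, Theorem 10.11] -/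
theorem tExpect_prodBad_univ_pos [NeZero N] [NeZero (N * b)] (hd : 2 ≤ d) (hN : Even N) (hb : 2 ≤ b)
    (p : ℤˣ) (β : ℝ) : 0 < tExpect N b p β (prodBad N b (univ : Finset (BlockIdx d N))) := by
  classical
  obtain ⟨σ₀, hσ₀, hbad⟩ := exists_forall_badCell hd hN hb p
  rw [tExpect_eq_tBsum_div hb]
  refine div_pos ?_ (tBsum_one_pos p β)
  rw [tBsum]
  refine lt_of_lt_of_le ?_ (single_le_sum (fun σ _ => mul_nonneg (Real.exp_pos _).le (prodBad_nonneg _ σ)) hσ₀)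
  refine mul_pos (Real.exp_pos _) ?_
  rw [prodBad]
  refine prod_pos fun c _ => ?_
  rw [badIdx, badInd, if_pos (hbad _)]
  exact one_pos

/-! ### The chessboard estimate -/

/-- **The chessboard estimate for bad cells** (Friedli–Velenik Theorem 10.11; Fröhlich–Lieb 1978):
on the torus `(ℤ/Nbℤ)^d` with `N = 2^(n+1)`, `d ≥ 2`, `b ≥ 2`, frozen alternating image spins of
either parity and any `β`: if the probability that ALL cells are bad is at most `ε^(N^d)` (`ε ≥ 0`),
then for every set `S` of cells the probability that all cells of `S` are bad is at most `ε^#S`.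
[cite: FriedliVelenik2017, Theorem 10.11] -/
theorem tExpect_prodBad_le_pow [NeZero N] [NeZero (N * b)] {n : ℕ} (hd : 2 ≤ d) (hNn : N = 2 ^ (n + 1))
    (hb : 2 ≤ b) (p : ℤˣ) (β : ℝ) {ε : ℝ} (hε : 0 ≤ ε)
    (huniv : tExpect N b p β (prodBad N b (univ : Finset (BlockIdx d N))) ≤ ε ^ (N ^ d))
    (S : Finset (BlockIdx d N)) : tExpect N b p β (prodBad N b S) ≤ ε ^ #S := by
  have hN : Even N := hNn ▸ Nat.even_pow.2 ⟨even_two, Nat.succ_ne_zero n⟩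
  refine chessboard_le_pow_of_le hNn (ψ := fun S => tExpect N b p β (prodBad N b S))
    (fun S => tExpect_nonneg hb p β (prodBad_nonneg S)) ?_ (tExpect_prodBad_univ_pos hd hN hb p β)
    (fun i k S => tExpect_prodBad_sq_le hN hb p β i k S) hε huniv S
  show tExpect N b p β (prodBad N b ∅) ≤ 1
  have : prodBad N b (∅ : Finset (BlockIdx d N)) = fun _ : SpinConfig (TorusSite d (N * b)) => (1 : ℝ) := by
    funext σ; simp [prodBad]
  rw [this, tExpect_one hb]

/-- **The chessboard estimate for cells indexed by lower corners in `ℤ^d`**: if the corners in `C` are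
pairwise incongruent mod `N` (e.g. `C` has sup-diameter `< N`), the probability that all the cells
`[cb, cb+b]^d`, `c ∈ C`, of the torus are bad is at most `ε^#C`. [cite: FriedliVelenik2017, Theorem 10.11] -/
theorem tExpect_prod_badInd_le_pow [NeZero N] [NeZero (N * b)] {n : ℕ} (hd : 2 ≤ d) (hNn : N = 2 ^ (n + 1))
    (hb : 2 ≤ b) (p : ℤˣ) (β : ℝ) {ε : ℝ} (hε : 0 ≤ ε)
    (huniv : tExpect N b p β (prodBad N b (univ : Finset (BlockIdx d N))) ≤ ε ^ (N ^ d))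
    (C : Finset (Site d)) (hC : Set.InjOn (fun c : Site d => fun j => (c j : ZMod N)) C) :
    tExpect N b p β (fun σ => ∏ c ∈ C, badInd N b c σ) ≤ ε ^ #C := by
  classical
  have h := tExpect_prodBad_le_pow hd hNn hb p β hε huniv (C.image fun c : Site d => fun j => (c j : ZMod N))
  rw [card_image_of_injOn hC] at h
  convert h using 2
  funext σ
  rw [prodBad, prod_image hC]
  exact prod_congr rfl fun c _ => (badIdx_intCast c σ).symm

end ChessboardCells

end Literature.Barriers.CriticalPhenomena.NonGibbs

end
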